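import Mathlib
import Summits.Schanuel.Schanuel.Statement
import Literature.NumberTheory.Transcendental.RoyCriterion
import Literature.NumberTheory.Transcendental.RoyCriterionProofs
import Literature.NumberTheory.Transcendental.RoyCriterionProp3Proofs
import Literature.NumberTheory.Transcendental.RoyCriterionProp2Proofs
import HarnessLib

/-!
# Roy's hypothesis is torsion-exponentiality (solo-Schanuel-blind)

Let `(s₀, s₁, t₀, t₁, u)` be any admissible parameter quintuple (Roy's window (1)).  For an
arbitrary tuple `y : Fin l → ℂ` (no linear independence assumed) and `α : Fin l → ℂ` with all
`α j ≠ 0`, the hypothesis of Roy's Conjecture 2 — `RoyHypothesis y α s₀ s₁ t₀ t₁ u`: a sequence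
of non-zero `P_N ∈ ℤ[X₀, X₁]` of controlled degrees and height whose `D`-derivatives of order
`≤ N^{s₀}` are `≤ e^{-N^u}` on the box `{(∑ mⱼyⱼ, ∏ αⱼ^{mⱼ}) : mⱼ ≤ N^{s₁}}` — holds **if and
only if** every `αⱼ e^{-yⱼ}` is a root of unity (`RoyConditionA (y j) (α j)` for all `j`).

* `→` (`forall_royConditionA_of_royHypothesis`): restriction to one generator
  (`royConditionB_of_royHypothesis`) and Roy's Theorem 1 `(b) ⇒ (a)` (`royThm1BtoA_holds`,
  i.e. Proposition 3 of [Roy2001]);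
* `←` (`royHypothesis_of_forall_royConditionA`): Roy's Proposition 2 *for tuples* — with `d`
  a common torsion order, the polynomial `Q_N ∈ ℤ[X₀, X₁^d]` of `exists_royAuxPolyD`, small on
  the disc `|z| ≤ 1 + (∑‖yⱼ‖) N^{s₁}`, evaluated along
  `t ↦ Q_N(z₀ + t, (∏ αⱼ^{mⱼ}) eᵗ) = Q_N(z₀ + t, e^{z₀ + t})` (`z₀ = ∑ mⱼ yⱼ`), plus Cauchy's
  inequalities on `|t| = 1` and `k! e^{-2N^u} ≤ e^{-N^u}`, verbatim as in `Roy2001_prop2_holds`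
  (the case `l = 1`).

Consequences recorded here:

* `royHypothesis_iff_forall_royConditionA` — the equivalence; in particular the hypothesis
  does not depend on the admissible parameters (`royHypothesis_iff_of_royAdmissible`);
* `royCriterion_iff_torsionTranslate` — Roy's criterion `RoyCriterion l` unfolds, with no
  auxiliary polynomial left, to *Schanuel's conjecture in rank `l` for torsion translates*:
  `∀ y α, LinearIndependent ℚ y → (∀ j, αⱼ e^{-yⱼ} ∈ μ_∞) → l ≤ trdeg ℚ(y, α)`;
* `schanuel_iff_forall_torsionTranslate` — hence `Schanuel` itself is that statement for
  all `l` (via the in-tree `Roy2001_iff_holds`).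

Reading (the point of this file): the in-tree equivalence `RoyCriterion l ↔ SchanuelRank l`
([Roy2001], §5) transports no structure — once Theorem 1 is available, the hypothesis of
Conjecture 2 *is* the statement `α ∈ μ_∞ · e^{y}`.  Any proof of Conjecture 2 that begins by
invoking Theorem 1 is a proof of Schanuel's conjecture outright; the arithmetic content Roy
asks for ([Roy2001], p. 185: "a reasonable approach toward Schanuel's conjecture") is a
*direct* passage from the polynomials `P_N` to the transcendence degree, i.e. a small value
estimate in the over-determined regime of window (1).

[cite: Roy2001 = D. Roy, *An arithmetic criterion for the values of the exponential
function*, Acta Arith. 97 (2001), 183–194 — Thm. 1, Prop. 2, Prop. 3, §5.]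
-/

noncomputable section

open MvPolynomial Filter Complex Metric
open Literature.NumberTheory.Transcendental

namespace Summit.Schanuel.Schanuel.Theorems

/-- **Roy's Proposition 2 for tuples.** If every `αⱼ e^{-yⱼ}` is a root of unity then the
hypothesis of Roy's Conjecture 2 holds for `(y, α)` and every admissible parameter choice —
no linear independence of `y` is needed. Proof: `exists_royAuxPolyD` with a common torsion
order `d`, and Cauchy's inequalities, as in `Roy2001_prop2_holds`.
[cite: Roy2001, Prop. 2 and §5 (2°)] -/
theorem royHypothesis_of_forall_royConditionA {l : ℕ} (y α : Fin l → ℂ) {s₀ s₁ t₀ t₁ u : ℝ}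
    (hadm : RoyAdmissible s₀ s₁ t₀ t₁ u) (hA : ∀ j, RoyConditionA (y j) (α j)) :
    RoyHypothesis y α s₀ s₁ t₀ t₁ u := by
  obtain ⟨hs₀, hs₁, ht₀, ht₁, _hu, h1, h2, h3⟩ := hadm
  have hs₀u : s₀ < u := (le_max_left _ _).trans_lt h2
  have hst : s₁ + t₁ < u := (le_max_right _ _).trans_lt h2
  have h1s₀ : 1 < s₀ := (le_max_left _ _).trans_lt (h1.trans_le (min_le_left _ _))
  have ht₀s₀ : t₀ < s₀ :=
    ((le_max_left _ _).trans (le_max_right _ _)).trans_lt (h1.trans_le (min_le_left _ _))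
  have h1u : 1 < u := h1s₀.trans hs₀u
  have ht₀u : t₀ < u := ht₀s₀.trans hs₀u
  -- torsion data: `ζⱼ = αⱼ e^{-yⱼ}` with `ζⱼ^{dⱼ} = 1`, and a common order `d`
  choose dj hdj hζ using fun j => (royCondA_iff _ _).1 (hA j)
  obtain ⟨ζ, hζ_def⟩ : ∃ ζ : Fin l → ℂ, ζ = fun j => α j * cexp (-y j) := ⟨_, rfl⟩
  have hζ1 : ∀ j, ζ j ^ dj j = 1 := by intro j; rw [hζ_def]; exact hζ j
  obtain ⟨d, hd1, hdvd⟩ : ∃ d : ℕ, 1 ≤ d ∧ ∀ j, dj j ∣ d :=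
    ⟨∏ j, dj j, Nat.one_le_iff_ne_zero.2 (Finset.prod_ne_zero_iff.2 fun j _ => by
      have := hdj j; omega), fun j => Finset.dvd_prod_of_mem dj (Finset.mem_univ j)⟩
  have hζd : ∀ j, ζ j ^ d = 1 := by
    intro j
    obtain ⟨e, he⟩ := hdvd j
    rw [he, pow_mul, hζ1 j, one_pow]
  have hαζ : ∀ j, α j = ζ j * cexp (y j) := by
    intro j
    rw [hζ_def]
    simp only [mul_assoc, ← Complex.exp_add, neg_add_cancel, Complex.exp_zero, mul_one]
  set c : ℝ := ∑ j, ‖y j‖ with hc_def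
  have hc : 0 ≤ c := Finset.sum_nonneg fun j _ => norm_nonneg _
  filter_upwards [exists_royAuxPolyD hs₁ ht₀ ht₁ h1u ht₀u hst h3 hd1 hc,
    eventually_factorial_mul_exp_le hs₀ hs₀u] with N hN hfact
  obtain ⟨Q, hQ0, hdeg0, hdeg1, hH, hinv, hval⟩ := hN
  refine ⟨Q, hQ0, hdeg0, hdeg1, hH, fun k m hk hm => ?_⟩
  set z₀ : ℂ := ∑ j, (m j : ℂ) * y j with hz₀_def
  set β : ℂ := ∏ j, α j ^ m j with hβ_def
  set η : ℂ := ∏ j, ζ j ^ m j with hη_def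
  have hηd : η ^ d = 1 := by
    rw [hη_def, ← Finset.prod_pow]
    refine Finset.prod_eq_one fun j _ => ?_
    rw [← pow_mul, mul_comm, pow_mul, hζd j, one_pow]
  have hβη : β = η * cexp z₀ := by
    rw [hβ_def, hη_def, hz₀_def, Complex.exp_sum, ← Finset.prod_mul_distrib]
    refine Finset.prod_congr rfl fun j _ => ?_
    rw [hαζ j, mul_pow, ← Complex.exp_nat_mul]
  have hz₀ : ‖z₀‖ ≤ c * (N : ℝ) ^ s₁ := by
    calc ‖z₀‖ ≤ ∑ j, ‖(m j : ℂ) * y j‖ := norm_sum_le _ _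
      _ ≤ ∑ j, (N : ℝ) ^ s₁ * ‖y j‖ := by
          refine Finset.sum_le_sum fun j _ => ?_
          rw [norm_mul, Complex.norm_natCast]
          exact mul_le_mul_of_nonneg_right (hm j) (norm_nonneg _)
      _ = c * (N : ℝ) ^ s₁ := by rw [hc_def, Finset.sum_mul]; simp [mul_comm]
  -- `F(t) = Q(z₀ + t, β eᵗ) = Q(z₀ + t, e^{z₀ + t})`
  set F : ℂ → ℂ := fun s => aeval ![z₀ + s, β * cexp s] Q with hFdef
  have hFeq : ∀ s, F s = expEval Q (z₀ + s) := by
    intro s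
    have hpt : β * cexp s = η * cexp (z₀ + s) := by rw [hβη, Complex.exp_add]; ring
    simp only [hFdef, expEval_apply, hpt]
    exact hinv η hηd _ _
  have hderiv : aeval ![z₀, β] (royD^[k] Q) = iteratedDeriv k F 0 := by
    rw [hFdef, iteratedDeriv_aeval_add_mul_exp]
    simp
  have hFdiff : Differentiable ℂ F := fun s =>
    (hasDerivAt_aeval_add_mul_exp Q z₀ β s).differentiableAt
  have hsphere : ∀ s ∈ sphere (0 : ℂ) 1, ‖F s‖ ≤ Real.exp (-(2 * (N : ℝ) ^ u)) := by
    intro s hs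
    rw [hFeq]
    refine hval _ ?_
    have hs1 : ‖s‖ = 1 := by simpa using hs
    calc ‖z₀ + s‖ ≤ ‖z₀‖ + ‖s‖ := norm_add_le _ _
      _ ≤ c * (N : ℝ) ^ s₁ + 1 := by rw [hs1]; gcongr
      _ = 1 + c * (N : ℝ) ^ s₁ := by ring
  have hC := Complex.norm_iteratedDeriv_le_of_forall_mem_sphere_norm_le (f := F) k one_pos
    hFdiff.diffContOnCl hsphere
  rw [hderiv]
  calc ‖iteratedDeriv k F 0‖ ≤ k.factorial * Real.exp (-(2 * (N : ℝ) ^ u)) / 1 ^ k := hC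
    _ = k.factorial * Real.exp (-(2 * (N : ℝ) ^ u)) := by rw [one_pow, div_one]
    _ ≤ Real.exp (-(N : ℝ) ^ u) := hfact k hk

/-- `→`: Roy's hypothesis for the tuple forces every `αⱼ e^{-yⱼ}` to be a root of unity
(restriction to the `j`-th generator and Theorem 1 `(b) ⇒ (a)`). [cite: Roy2001, Thm. 1] -/
theorem forall_royConditionA_of_royHypothesis {l : ℕ} {y α : Fin l → ℂ} (hα : ∀ j, α j ≠ 0)
    {s₀ s₁ t₀ t₁ u : ℝ} (hadm : RoyAdmissible s₀ s₁ t₀ t₁ u)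
    (h : RoyHypothesis y α s₀ s₁ t₀ t₁ u) : ∀ j, RoyConditionA (y j) (α j) :=
  fun j => royThm1BtoA_holds (y j) (α j) (hα j) s₀ s₁ t₀ t₁ u hadm
    (royConditionB_of_royHypothesis h j)

/-- **Roy's hypothesis is torsion-exponentiality**: for admissible parameters and `αⱼ ≠ 0`,
`RoyHypothesis y α s₀ s₁ t₀ t₁ u ↔ ∀ j, αⱼ e^{-yⱼ}` is a root of unity.
[cite: Roy2001, Thm. 1, Prop. 2] -/
theorem royHypothesis_iff_forall_royConditionA {l : ℕ} {y α : Fin l → ℂ} (hα : ∀ j, α j ≠ 0)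
    {s₀ s₁ t₀ t₁ u : ℝ} (hadm : RoyAdmissible s₀ s₁ t₀ t₁ u) :
    RoyHypothesis y α s₀ s₁ t₀ t₁ u ↔ ∀ j, RoyConditionA (y j) (α j) :=
  ⟨forall_royConditionA_of_royHypothesis hα hadm,
    royHypothesis_of_forall_royConditionA y α hadm⟩

/-- The hypothesis of Conjecture 2 does not depend on the choice of admissible parameters.
[cite: Roy2001, Thm. 1, Prop. 2] -/
theorem royHypothesis_iff_of_royAdmissible {l : ℕ} {y α : Fin l → ℂ} (hα : ∀ j, α j ≠ 0)
    {s₀ s₁ t₀ t₁ u s₀' s₁' t₀' t₁' u' : ℝ} (hadm : RoyAdmissible s₀ s₁ t₀ t₁ u)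
    (hadm' : RoyAdmissible s₀' s₁' t₀' t₁' u') :
    RoyHypothesis y α s₀ s₁ t₀ t₁ u ↔ RoyHypothesis y α s₀' s₁' t₀' t₁' u' := by
  rw [royHypothesis_iff_forall_royConditionA hα hadm,
    royHypothesis_iff_forall_royConditionA hα hadm']

/-- Condition (a) forces `α ≠ 0`. [cite: Roy2001, Thm. 1 (a)] -/
theorem ne_zero_of_royConditionA {y α : ℂ} (h : RoyConditionA y α) : α ≠ 0 := by
  rintro rfl
  obtain ⟨d, hd, hd'⟩ := h
  rw [zero_pow (by omega)] at hd'
  exact Complex.exp_ne_zero _ hd'.symm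

/-- **Roy's criterion unfolded**: `RoyCriterion l` is Schanuel's conjecture in rank `l` for
torsion translates of exponential tuples — for `y` linearly independent over `ℚ` and `αⱼ` with
`αⱼ e^{-yⱼ} ∈ μ_∞`, `tr.deg_ℚ ℚ(y, α) ≥ l`. No auxiliary polynomial remains in the statement.
[cite: Roy2001, Conjecture 2, Thm. 1, Prop. 2] -/
theorem royCriterion_iff_torsionTranslate (l : ℕ) :
    RoyCriterion l ↔ ∀ (y α : Fin l → ℂ), LinearIndependent ℚ y →
      (∀ j, RoyConditionA (y j) (α j)) →
        (l : Cardinal) ≤ Algebra.trdeg ℚ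
          ↥(IntermediateField.adjoin ℚ (Set.range y ∪ Set.range α)) := by
  constructor
  · intro hR y α hy hA
    exact hR y α hy (fun j => ne_zero_of_royConditionA (hA j)) _ _ _ _ _ royAdmissible_example
      (royHypothesis_of_forall_royConditionA y α royAdmissible_example hA)
  · intro H y α hy hα s₀ s₁ t₀ t₁ u hadm hhyp
    exact H y α hy (forall_royConditionA_of_royHypothesis hα hadm hhyp)

/-- **Schanuel's conjecture as the torsion-translate statement for all ranks** (through the
in-tree `Roy2001_iff_holds`). [cite: Roy2001, §5] -/
theorem schanuel_iff_forall_torsionTranslate :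
    _root_.Schanuel ↔ ∀ (l : ℕ) (y α : Fin l → ℂ), LinearIndependent ℚ y →
      (∀ j, RoyConditionA (y j) (α j)) →
        (l : Cardinal) ≤ Algebra.trdeg ℚ
          ↥(IntermediateField.adjoin ℚ (Set.range y ∪ Set.range α)) := by
  refine forall_congr' fun l => ?_
  rw [← royCriterion_iff_torsionTranslate]
  exact (Roy2001_iff_holds l).symm

#harness_tags schanuel_iff_forall_torsionTranslate

end Summit.Schanuel.Schanuel.Theorems

end
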